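import Literature.Geometry.GeometricMeasureTheory.SuperlevelStokes
import Literature.Geometry.GeometricMeasureTheory.RectifiableImagePieceData
import Mathlib.Analysis.Normed.Lp.MeasurableSpace
import Mathlib.MeasureTheory.Measure.Haar.InnerProductSpace
import HarnessLib

/-!
# The level-set current of a chart at a regular level

Let `Ψ : ℝ^{m+1} ⊇ O₀ → V` be a smooth injective immersion into a finite-dimensional real inner
product space with a Lipschitz left inverse `ℓ` (`ℓ (Ψ x) = x` on `O₀`), and `G` a smooth function
on `O₀` with `dG(k₁) ≠ 0`. Then on a neighbourhood `O₁` of `k₁` the **boundary of the superlevel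
sets `{G > s}` computed through the chart is the current of integration over the image of the level
set**: for every level `s` there are admissible rectifiable data
`(Ψ(O₁ ∩ G⁻¹{s}), θ_s, ξ_s)` (Federer 4.1.28 (4); here the image data of a bi-Lipschitz
parametrisation of the level set over `ℝ^m`, `isRectifiableData_image_density`) such that

  `∫_{O₁ ∩ {s < G}} (Ψ^* dφ)(e₀, …, e_m) dx = [Ψ(O₁ ∩ G⁻¹{s}), θ_s, ξ_s](φ)`

for every test form `φ` on `V` whose pull-back `φ ∘ Ψ` is supported in a compact subset of `O₁`
(`exists_levelSet_chartData`). This is the smooth, chart-level case of Federer's formula for the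
slices of a rectifiable current [Federer1969, 4.3.8], obtained here from the local Gauss–Green
formula of `SuperlevelStokes.lean` (straightening `exists_straighten`, then
`integral_extDeriv_image_superlevel_eq`), the chain rule, and the transport of the level-set
parametrisation `y ↦ Ψ(Φ(insᵢ s y))` to the parameter space `EuclideanSpace ℝ (Fin m)` of
`RectifiableImagePieceData.lean`.

Theorems only; no definitions, no named facts.

## References

* H. Federer, *Geometric Measure Theory*, Springer 1969, 3.2.3, 4.1.7, 4.1.28, 4.3.8 [Federer1969].
* M. Spivak, *Calculus on Manifolds*, Benjamin 1965, Thm. 5-5 [Spivak1965].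
-/

noncomputable section

open scoped Topology ContDiff NNReal ENNReal
open MeasureTheory Set Function Filter Metric WithLp

namespace Literature.Geometry.GeometricMeasureTheory

-- Nested operator-norm instances on (duals of) `V [⋀^Fin n]→L[ℝ] ℝ`.
set_option maxSynthPendingDepth 2

variable {V : Type*} [NormedAddCommGroup V] [InnerProductSpace ℝ V] [FiniteDimensional ℝ V]
  [MeasurableSpace V] [BorelSpace V] {m : ℕ}

/-! ### Plumbing: the linear insertion `y ↦ insᵢ 0 y` -/

section Insert

/-- A continuous linear form on `ℝ^{m+1}` vanishing on the coordinate vectors vanishes. [folklore] -/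
private theorem exists_apply_single_ne_zero' {G' : (Fin (m + 1) → ℝ) →L[ℝ] ℝ} (hG' : G' ≠ 0) :
    ∃ i : Fin (m + 1), G' (Pi.single i 1) ≠ 0 := by
  by_contra hcon
  push Not at hcon
  refine hG' (ContinuousLinearMap.ext fun w => ?_)
  rw [zero_apply, pi_eq_sum_univ w, map_sum]
  refine Finset.sum_eq_zero fun i _ => ?_
  rw [show (w i • fun j => if i = j then (1 : ℝ) else 0) = w i • (Pi.single i 1 : Fin (m + 1) → ℝ)
    from by ext j; simp [Pi.single_apply, eq_comm], map_smul, hcon i, smul_zero]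

/-- **The linear insertion `y ↦ insᵢ 0 y`** exists as a continuous linear map `L` with
`insᵢ s y = eᵢ s + L y`, `L e'ⱼ = e_{succAbove i j}`, and `L` injective. [folklore] -/
private theorem exists_insertNth_clm (i : Fin (m + 1)) :
    ∃ L : (Fin m → ℝ) →L[ℝ] (Fin (m + 1) → ℝ), (∀ y, L y = i.insertNth (0 : ℝ) y) ∧
      (∀ s y, i.insertNth s y = (Pi.single i s : Fin (m + 1) → ℝ) + L y) ∧
      (∀ j, L (Pi.single j 1) = Pi.single (i.succAbove j) 1) ∧ Injective L := by
  have hsmul : ∀ (c : ℝ) (y : Fin m → ℝ), i.insertNth (0 : ℝ) (c • y) = c • i.insertNth (0 : ℝ) y := by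
    intro c y
    ext j
    obtain h | ⟨l, h⟩ := Fin.eq_self_or_eq_succAbove i j
    · rw [h]; simp
    · rw [h]; simp
  set L : (Fin m → ℝ) →L[ℝ] (Fin (m + 1) → ℝ) := LinearMap.toContinuousLinearMap
    { toFun := fun y => i.insertNth (0 : ℝ) y
      map_add' := fun y y' => by simpa using Fin.insertNth_add (α := fun _ => ℝ) i 0 0 y y'
      map_smul' := fun c y => hsmul c y } with hL
  have hLy : ∀ y, L y = i.insertNth (0 : ℝ) y := fun y => rfl
  refine ⟨L, hLy, fun s y => ?_, fun j => ?_, fun y y' h => ?_⟩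
  · rw [hLy, ← Fin.insertNth_zero_right, ← Fin.insertNth_add (α := fun _ => ℝ), add_zero, zero_add]
  · rw [hLy]
    ext l
    obtain h | ⟨l', h⟩ := Fin.eq_self_or_eq_succAbove i l
    · rw [h, Fin.insertNth_apply_same, Pi.single_eq_of_ne (Fin.succAbove_ne i j).symm]
    · rw [h, Fin.insertNth_apply_succAbove]
      by_cases h' : l' = j
      · subst h'; simp
      · rw [Pi.single_eq_of_ne h', Pi.single_eq_of_ne (fun h'' => h' (Fin.succAbove_right_injective h''))]
  · ext j
    have := congrFun h (i.succAbove j)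
    simpa [hLy] using this

end Insert

/-! ### The level-set current of a chart -/

section Main

/-- **The level-set current of a chart at a regular level.** Let `Ψ` be smooth on an open
`O₀ ⊆ ℝ^{m+1}` with injective differentials and a Lipschitz left inverse `ℓ`, and `G` smooth on `O₀`
with `dG(k₁) ≠ 0`, `k₁ ∈ O₀`. Then there is an open `O₁`, `k₁ ∈ O₁ ⊆ O₀`, such that for every level
`s` some admissible rectifiable data `(Ψ(O₁ ∩ G⁻¹{s}), θ, ξ)` (on every open `Ω ⊇ Ψ(O₁)`) satisfy
`∫_{O₁ ∩ {s < G}} (Ψ^* dφ)(e₀, …, e_m) dx = [Ψ(O₁ ∩ G⁻¹{s}), θ, ξ](φ)` for all test forms `φ` on `Ω`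
with `φ ∘ Ψ` supported (within `O₀`) in a compact subset of `O₁`: the boundary of the superlevel
set through the chart is the image of the level set, parametrised bi-Lipschitzly over `ℝ^m` by
`z ↦ Ψ(Φ(insᵢ s z))` for a straightening `Φ` of `G`. [cite: Federer1969, 4.3.8, 4.1.28 (4), 3.2.3;
Spivak1965, Thm. 5-5] -/
theorem exists_levelSet_chartData {O₀ : Set (Fin (m + 1) → ℝ)} (hO₀ : IsOpen O₀)
    {Ψ : (Fin (m + 1) → ℝ) → V} (hΨ : ContDiffOn ℝ ∞ Ψ O₀)
    (hΨinj : ∀ x ∈ O₀, Injective (fderiv ℝ Ψ x))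
    {ℓ : V → (Fin (m + 1) → ℝ)} {Kℓ : ℝ≥0} (hℓ : LipschitzWith Kℓ ℓ) (hℓΨ : ∀ x ∈ O₀, ℓ (Ψ x) = x)
    {G : (Fin (m + 1) → ℝ) → ℝ} (hG : ContDiffOn ℝ ∞ G O₀) {k₁ : Fin (m + 1) → ℝ} (hk₁ : k₁ ∈ O₀)
    (hdG : fderiv ℝ G k₁ ≠ 0) :
    ∃ O₁ : Set (Fin (m + 1) → ℝ), IsOpen O₁ ∧ k₁ ∈ O₁ ∧ O₁ ⊆ O₀ ∧
      ∀ s : ℝ, ∃ (θ : V → ℤ) (ξ : V → Fin m → V),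
        (∀ Ω : TopologicalSpace.Opens V, Ψ '' O₁ ⊆ Ω →
          IsRectifiableData Ω m (Ψ '' (O₁ ∩ G ⁻¹' {s})) θ ξ) ∧
        ∀ (Ω : TopologicalSpace.Opens V) (φ : TestForm Ω m) (C : Set (Fin (m + 1) → ℝ)),
          IsCompact C → C ⊆ O₁ → (∀ x ∈ O₀, x ∉ C → ⇑φ (Ψ x) = 0) →
          ∫ x in O₁ ∩ {x | s < G x},
              (extDeriv ⇑φ (Ψ x)).compContinuousLinearMap (fderiv ℝ Ψ x) (fun k => Pi.single k 1) =
            currentOfIntegration (Ψ '' (O₁ ∩ G ⁻¹' {s})) θ ξ φ := by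
  classical
  -- a coordinate with `∂ᵢ G(k₁) ≠ 0` and the straightening `Φ`
  obtain ⟨i, hi⟩ := exists_apply_single_ne_zero' hdG
  obtain ⟨Φ, hΦO₀, hk₁Φ, hΦs, hGΦ, hΦj, hΦinj, σ, hσ, hdet⟩ := exists_straighten hO₀ hG hk₁ hi
  obtain ⟨L, hLy, hins, hLe, hLinj⟩ := exists_insertNth_clm (m := m) i
  have hsrc : IsOpen Φ.source := Φ.open_source
  -- the composite chart `F = Ψ ∘ Φ` on `Φ.source`
  set F : (Fin (m + 1) → ℝ) → V := fun u => Ψ (Φ u) with hF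
  have hΦmaps : MapsTo Φ Φ.source O₀ := fun u hu => hΦO₀ (Φ.map_source hu)
  have hFs : ContDiffOn ℝ ∞ F Φ.source := hΨ.comp hΦs hΦmaps
  have hFd : ∀ u ∈ Φ.source, HasFDerivAt F (fderiv ℝ F u) u := fun u hu =>
    ((hFs.differentiableOn (by simp)) u hu).differentiableAt (hsrc.mem_nhds hu) |>.hasFDerivAt
  have hFderiv : ∀ u ∈ Φ.source, fderiv ℝ F u = (fderiv ℝ Ψ (Φ u)).comp (fderiv ℝ Φ u) :=
    fun u hu => by
    have hΨd : DifferentiableAt ℝ Ψ (Φ u) :=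
      ((hΨ.differentiableOn (by simp)) _ (hΦmaps hu)).differentiableAt (hO₀.mem_nhds (hΦmaps hu))
    have hΦd : DifferentiableAt ℝ Φ u :=
      ((hΦs.differentiableOn (by simp)) u hu).differentiableAt (hsrc.mem_nhds hu)
    exact fderiv_comp u hΨd hΦd
  have hFinj : ∀ u ∈ Φ.source, Injective (fderiv ℝ F u) := fun u hu => by
    rw [hFderiv u hu]
    exact (hΨinj _ (hΦmaps hu)).comp (hΦinj u hu)
  have hFcont : ContinuousOn (fderiv ℝ F) Φ.source := hFs.continuousOn_fderiv_of_isOpen hsrc (by simp)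
  -- a ball `B` around `u₁ = Φ⁻¹ k₁` with closure in the source; `Φ₁ = Φ|B`, `O₁ = Φ(B)`
  set u₁ := Φ.symm k₁ with hu₁
  have hu₁src : u₁ ∈ Φ.source := Φ.map_target hk₁Φ
  have hΦu₁ : Φ u₁ = k₁ := Φ.right_inv hk₁Φ
  obtain ⟨r, hr, hrsrc⟩ : ∃ r > 0, closedBall u₁ r ⊆ Φ.source := by
    obtain ⟨r, hr, h⟩ := Metric.nhds_basis_closedBall.mem_iff.1 (hsrc.mem_nhds hu₁src)
    exact ⟨r, hr, h⟩
  set B : Set (Fin (m + 1) → ℝ) := ball u₁ r with hB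
  have hBsrc : B ⊆ Φ.source := ball_subset_closedBall.trans hrsrc
  set Φ₁ := Φ.restrOpen B isOpen_ball with hΦ₁
  have hΦ₁src : Φ₁.source = B := by
    rw [hΦ₁, Φ.restrOpen_source]; exact inter_eq_right.2 hBsrc
  have hΦ₁coe : (Φ₁ : (Fin (m + 1) → ℝ) → (Fin (m + 1) → ℝ)) = Φ := rfl
  set O₁ : Set (Fin (m + 1) → ℝ) := Φ₁.target with hO₁
  have hO₁o : IsOpen O₁ := Φ₁.open_target
  have hO₁sub : O₁ ⊆ Φ.target := fun x hx => by
    have := Φ₁.map_target hx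
    rw [hΦ₁src] at this
    have h2 : Φ₁ (Φ₁.symm x) = x := Φ₁.right_inv hx
    rw [← h2]
    exact Φ.map_source (hBsrc this)
  have hO₁O₀ : O₁ ⊆ O₀ := hO₁sub.trans hΦO₀
  have hk₁O₁ : k₁ ∈ O₁ := by
    rw [← hΦu₁]
    exact Φ₁.map_source (by rw [hΦ₁src]; exact mem_ball_self hr)
  -- bounds on the closed ball: `DF` bounded, `F` Lipschitz on `B`
  obtain ⟨CF, hCF⟩ : ∃ C, ∀ u ∈ closedBall u₁ r, ‖fderiv ℝ F u‖ ≤ C :=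
    (isCompact_closedBall u₁ r).exists_bound_of_continuousOn (hFcont.mono hrsrc)
  have hCF0 : 0 ≤ CF := (norm_nonneg _).trans (hCF u₁ (mem_closedBall_self hr.le))
  have hFlip : LipschitzOnWith ⟨CF, hCF0⟩ F B :=
    (convex_ball u₁ r).lipschitzOnWith_of_nnnorm_fderiv_le
      (fun u hu => ((hFs.differentiableOn (by simp)) u (hBsrc hu)).differentiableAt
        (hsrc.mem_nhds (hBsrc hu)))
      (fun u hu => by
        rw [← NNReal.coe_le_coe, coe_nnnorm]
        exact hCF u (ball_subset_closedBall hu))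
  refine ⟨O₁, hO₁o, hk₁O₁, hO₁O₀, fun s => ?_⟩
  -- the sign
  obtain ⟨c, hc⟩ : ∃ c : ℤ, (c : ℝ) = -((-1 : ℝ) ^ (i : ℕ) * σ) := by
    rcases hσ with h | h <;> rcases neg_one_pow_eq_or ℝ (i : ℕ) with h' | h'
    · exact ⟨-1, by rw [h, h']; norm_num⟩
    · exact ⟨1, by rw [h, h']; norm_num⟩
    · exact ⟨1, by rw [h, h']; norm_num⟩
    · exact ⟨-1, by rw [h, h']; norm_num⟩
  -- the parametrisation of the level set over `EuclideanSpace ℝ (Fin m)`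
  set ι : EuclideanSpace ℝ (Fin m) → (Fin (m + 1) → ℝ) := fun z => i.insertNth s (ofLp z) with hι
  set Mo : EuclideanSpace ℝ (Fin m) →L[ℝ] (Fin (m + 1) → ℝ) :=
    L.comp (PiLp.continuousLinearEquiv 2 ℝ (fun _ : Fin m => ℝ) :
      EuclideanSpace ℝ (Fin m) →L[ℝ] (Fin m → ℝ)) with hMo
  have hιeq : ∀ z, ι z = (Pi.single i s : Fin (m + 1) → ℝ) + Mo z := fun z => by
    simp only [hι, hMo, ContinuousLinearMap.comp_apply]
    rw [hins s (ofLp z)]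
    rfl
  have hιd : ∀ z, HasFDerivAt ι Mo z := fun z => by
    have : ι = fun z => (Pi.single i s : Fin (m + 1) → ℝ) + Mo z := funext hιeq
    rw [this]
    exact (Mo.hasFDerivAt).const_add _
  have hιcont : Continuous ι := by
    rw [show ι = fun z => (Pi.single i s : Fin (m + 1) → ℝ) + Mo z from funext hιeq]
    exact continuous_const.add Mo.continuous
  have hιi : ∀ z, ι z i = s := fun z => by simp [hι]
  have hιj : ∀ z j, ι z (i.succAbove j) = ofLp z j := fun z j => by simp [hι]
  have hMoe : ∀ j, Mo (EuclideanSpace.basisFun (Fin m) ℝ j) = Pi.single (i.succAbove j) 1 := by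
    intro j
    simp only [hMo, ContinuousLinearMap.comp_apply]
    rw [EuclideanSpace.basisFun_apply, ← hLe j]
    rfl
  set sE : Set (EuclideanSpace ℝ (Fin m)) := ι ⁻¹' B with hsE
  have hsEo : IsOpen sE := isOpen_ball.preimage hιcont
  set γ : EuclideanSpace ℝ (Fin m) → V := fun z => F (ι z) with hγ
  set γ' : EuclideanSpace ℝ (Fin m) → EuclideanSpace ℝ (Fin m) →L[ℝ] V :=
    fun z => (fderiv ℝ F (ι z)).comp Mo with hγ'
  have hγd : ∀ z ∈ sE, HasFDerivWithinAt γ (γ' z) sE z := fun z hz =>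
    ((hFd (ι z) (hBsrc hz)).comp z (hιd z)).hasFDerivWithinAt
  have hγ'inj : ∀ z ∈ sE, Injective (γ' z) := fun z hz =>
    (hFinj (ι z) (hBsrc hz)).comp (hLinj.comp (PiLp.continuousLinearEquiv 2 ℝ _).injective)
  -- the left inverse `z = toLp ((ℓ (γ z)) ∘ succAbove i)`: anti-Lipschitz
  set R : V → EuclideanSpace ℝ (Fin m) := fun v => toLp 2 (fun j => ℓ v (i.succAbove j)) with hR
  obtain ⟨KR, hRlip⟩ : ∃ KR, LipschitzWith KR R := by
    have h1 : LipschitzWith 1 (fun y : Fin (m + 1) → ℝ => fun j => y (i.succAbove j)) :=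
      LipschitzWith.of_dist_le_mul fun y y' => by
        rw [NNReal.coe_one, one_mul, dist_pi_le_iff dist_nonneg]
        exact fun j => dist_le_pi_dist y y' (i.succAbove j)
    exact ⟨_, ((PiLp.lipschitzWith_toLp 2 (fun _ : Fin m => ℝ)).comp h1).comp hℓ⟩
  have hRγ : ∀ z ∈ sE, R (γ z) = z := fun z hz => by
    have h1 : ℓ (γ z) = Φ (ι z) := hℓΨ _ (hΦmaps (hBsrc hz))
    simp only [hR, h1]
    have h2 : (fun j => Φ (ι z) (i.succAbove j)) = ofLp z := by
      ext j; rw [hΦj _ (hBsrc hz), hιj]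
    rw [h2, toLp_ofLp]
  have hγanti : AntilipschitzWith KR (sE.restrict γ) :=
    AntilipschitzWith.of_le_mul_dist fun z z' => by
      have := hRlip.dist_le_mul (γ z) (γ z')
      rw [hRγ z z.2, hRγ z' z'.2] at this
      exact this
  have hγinj : InjOn γ sE := fun z hz z' hz' h => by
    rw [← hRγ z hz, ← hRγ z' hz', h]
  -- Lipschitz on `sE`
  have hιlip : LipschitzWith ‖Mo‖₊ ι := by
    rw [show ι = fun z => (Pi.single i s : Fin (m + 1) → ℝ) + Mo z from funext hιeq]
    exact LipschitzWith.of_dist_le_mul fun z z' => by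
      rw [dist_add_left]; exact Mo.lipschitz.dist_le_mul z z'
  have hγlip : LipschitzOnWith (⟨CF, hCF0⟩ * ‖Mo‖₊) γ sE :=
    hFlip.comp hιlip.lipschitzOnWith fun z hz => hz
  -- integrability of the (bounded, continuous) parameter-side density
  set e := EuclideanSpace.basisFun (Fin m) ℝ with he
  have hγ'e : ∀ z j, γ' z (e j) = fderiv ℝ F (ι z) (Pi.single (i.succAbove j) 1) := fun z j => by
    simp only [hγ', ContinuousLinearMap.comp_apply, he]
    rw [hMoe j]
  have hint : IntegrableOn (fun z => (c : ℝ) • frameVector fun j => γ' z (e j)) sE := by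
    -- continuous on the compact `ι⁻¹ (closedBall u₁ r) ⊇ sE`
    have hK : IsCompact (ι ⁻¹' closedBall u₁ r) := by
      refine Metric.isCompact_of_isClosed_isBounded (isClosed_closedBall.preimage hιcont) ?_
      rw [Metric.isBounded_iff_subset_closedBall (0 : EuclideanSpace ℝ (Fin m))]
      refine ⟨(Fintype.card (Fin m) : ℝ≥0) ^ (1 / (2 : ℝ≥0∞)).toReal * (‖u₁‖ + r), fun z hz => ?_⟩
      rw [mem_closedBall, dist_zero_right]
      have h1 : ‖ofLp z‖ ≤ ‖u₁‖ + r := by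
        have hz' : ‖ι z‖ ≤ ‖u₁‖ + r := by
          have := mem_closedBall.1 hz
          calc ‖ι z‖ = ‖(ι z - u₁) + u₁‖ := by rw [sub_add_cancel]
            _ ≤ ‖ι z - u₁‖ + ‖u₁‖ := norm_add_le _ _
            _ ≤ r + ‖u₁‖ := by rw [← dist_eq_norm]; exact add_le_add this le_rfl
            _ = ‖u₁‖ + r := add_comm _ _
        refine (pi_norm_le_iff_of_nonneg (by positivity)).2 fun j => ?_
        rw [← hιj z j]
        exact (norm_le_pi_norm (ι z) _).trans hz'
      have h2 := (PiLp.lipschitzWith_toLp 2 (fun _ : Fin m => ℝ)).dist_le_mul (ofLp z) 0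
      rw [toLp_zero, dist_zero_right, dist_zero_right, toLp_ofLp] at h2
      exact h2.trans (mul_le_mul_of_nonneg_left h1 (by positivity))
    have hcont : ContinuousOn (fun z => (c : ℝ) • frameVector fun j =>
        fderiv ℝ F (ι z) (Pi.single (i.succAbove j) 1)) (ι ⁻¹' closedBall u₁ r) := by
      refine ContinuousOn.const_smul ((continuous_frameVector' (V := V) (n := m)).comp_continuousOn ?_) (c : ℝ)
      refine continuousOn_pi.2 fun j => ?_
      exact ((ContinuousLinearMap.apply ℝ V (Pi.single (i.succAbove j) 1)).continuous.comp_continuousOn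
        ((hFcont.mono hrsrc).comp hιcont.continuousOn fun z hz => hz))
    refine ((hcont.integrableOn_compact hK).mono_set
      (preimage_mono ball_subset_closedBall)).congr_fun (fun z _ => ?_) hsEo.measurableSet
    simp only [hγ'e]
  -- the data
  set θ : V → ℤ := imageDensity γ sE (fun _ => c) with hθ
  set ξ : V → Fin m → V := imageFrame γ γ' sE e with hξ
  have hγsub : γ '' sE ⊆ Ψ '' O₁ := by
    rintro _ ⟨z, hz, rfl⟩
    exact ⟨Φ (ι z), Φ₁.map_source (by rw [hΦ₁src]; exact hz), rfl⟩
  have hcar : γ '' sE = Ψ '' (O₁ ∩ G ⁻¹' {s}) := by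
    apply Subset.antisymm
    · rintro _ ⟨z, hz, rfl⟩
      refine ⟨Φ (ι z), ⟨Φ₁.map_source (by rw [hΦ₁src]; exact hz), ?_⟩, rfl⟩
      rw [mem_preimage, hGΦ _ (hBsrc hz), hιi, mem_singleton_iff]
    · rintro _ ⟨x, ⟨hxO₁, hxs⟩, rfl⟩
      have hu : Φ₁.symm x ∈ B := by rw [← hΦ₁src]; exact Φ₁.map_target hxO₁
      have hΦu : Φ (Φ₁.symm x) = x := Φ₁.right_inv hxO₁
      have hui : Φ₁.symm x i = s := by
        rw [← hGΦ _ (hBsrc hu), hΦu]; exact hxs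
      refine ⟨toLp 2 (Fin.removeNth i (Φ₁.symm x)), ?_, ?_⟩
      · show ι (toLp 2 (Fin.removeNth i (Φ₁.symm x))) ∈ B
        simp only [hι]
        rw [← hui, Fin.insertNth_self_removeNth]
        exact hu
      · simp only [hγ, hF, hι]
        rw [← hui, Fin.insertNth_self_removeNth, hΦu]
  have hdata : ∀ Ω : TopologicalSpace.Opens V, Ψ '' O₁ ⊆ Ω →
      IsRectifiableData Ω m (γ '' sE) θ ξ := fun Ω hΩ =>
    isRectifiableData_image_density hsEo.measurableSet hγd hγ'inj hγanti hγlip hint (hγsub.trans hΩ)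
  refine ⟨θ, ξ, fun Ω hΩ => by rw [← hcar]; exact hdata Ω hΩ, fun Ω φ C hC hCO₁ hφC => ?_⟩
  rw [← hcar, currentOfIntegration_image_density_apply hsEo.measurableSet hγd hγ'inj hγinj e hint]
  -- the pulled-back form `α = Ψ^*φ`, extended by zero off `O₀`
  set α : (Fin (m + 1) → ℝ) → (Fin (m + 1) → ℝ) [⋀^Fin m]→L[ℝ] ℝ :=
    fun x => if x ∈ O₀ then (⇑φ (Ψ x)).compContinuousLinearMap (fderiv ℝ Ψ x) else 0 with hα_def
  have hφ1 : ContDiff ℝ 1 ⇑φ := φ.contDiff.of_le (by exact_mod_cast le_top)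
  have hα₀ : ContDiffOn ℝ 1 (fun x => (⇑φ (Ψ x)).compContinuousLinearMap (fderiv ℝ Ψ x)) O₀ :=
    (hφ1.comp_contDiffOn (hΨ.of_le (WithTop.coe_le_coe.2 le_top))).continuousAlternatingMapCompContinuousLinearMap
      (hΨ.fderiv_of_isOpen hO₀ (WithTop.coe_le_coe.2 le_top))
  have hagree : ∀ x ∈ O₀, α =ᶠ[𝓝 x] fun x => (⇑φ (Ψ x)).compContinuousLinearMap (fderiv ℝ Ψ x) :=
    fun x hx => by
    filter_upwards [hO₀.mem_nhds hx] with x' hx'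
    simp [hα_def, hx']
  have hvanish : ∀ x ∉ C, α =ᶠ[𝓝 x] fun _ => 0 := fun x hx => by
    filter_upwards [hC.isClosed.isOpen_compl.mem_nhds hx] with x' hx'
    by_cases hx'O : x' ∈ O₀
    · simp only [hα_def, hx'O, if_true, hφC x' hx'O hx']
      ext v
      simp
    · simp [hα_def, hx'O]
  have hα : ContDiff ℝ 1 α := contDiff_iff_contDiffAt.2 fun x => by
    by_cases hx : x ∈ O₀
    · exact (hα₀.contDiffAt (hO₀.mem_nhds hx)).congr_of_eventuallyEq (hagree x hx)
    · exact contDiffAt_const.congr_of_eventuallyEq (hvanish x fun h => hx (hO₁O₀ (hCO₁ h)))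
  have hαs : HasCompactSupport α := by
    refine HasCompactSupport.intro hC fun x hx => ?_
    exact (hvanish x hx).self_of_nhds
  have hαsupp : tsupport α ⊆ Φ₁.target := by
    refine (closure_minimal (fun x hx => ?_) hC.isClosed).trans hCO₁
    by_contra hxC
    exact hx ((hvanish x hxC).self_of_nhds)
  -- `dα = Ψ^*(dφ)` on `O₀`
  have hdα : ∀ x ∈ O₀, (extDeriv ⇑φ (Ψ x)).compContinuousLinearMap (fderiv ℝ Ψ x)
      (fun k => Pi.single k 1) = extDeriv α x (fun k => Pi.single k 1) := fun x hx => by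
    have hΨx : ContDiffAt ℝ 2 Ψ x := (hΨ.of_le (WithTop.coe_le_coe.2 le_top)).contDiffAt (hO₀.mem_nhds hx)
    have hφx : DifferentiableAt ℝ ⇑φ (Ψ x) := (hφ1.differentiable one_ne_zero).differentiableAt
    rw [(hagree x hx).extDeriv_eq, extDeriv_pullback hφx hΨx]
    rw [minSmoothness_of_isRCLikeNormedField]
  -- (1) the integrand is `dα(e)` on `O₁`
  have hO₁G : IsOpen (O₁ ∩ {x | s < G x}) :=
    (hG.continuousOn.mono hO₁O₀).isOpen_inter_preimage hO₁o isOpen_Ioi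
  rw [setIntegral_congr_fun hO₁G.measurableSet (fun x hx => hdα x (hO₁O₀ hx.1))]
  -- (2) `O₁ ∩ {s < G} = Φ₁(Φ₁.source ∩ {s < uᵢ})`
  have hGΦ₁ : ∀ u ∈ Φ₁.source, G (Φ₁ u) = u i := fun u hu =>
    hGΦ u (hBsrc (by rw [← hΦ₁src]; exact hu))
  have hset : O₁ ∩ {x | s < G x} = Φ₁ '' (Φ₁.source ∩ {u | s < u i}) := by
    rw [Φ₁.image_source_inter_eq']
    ext x
    constructor
    · rintro ⟨hx, hGx⟩
      refine ⟨hx, ?_⟩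
      show s < Φ₁.symm x i
      rw [← hGΦ₁ _ (Φ₁.map_target hx), Φ₁.right_inv hx]; exact hGx
    · rintro ⟨hx, hx'⟩
      refine ⟨hx, ?_⟩
      show s < G x
      have : s < Φ₁.symm x i := hx'
      rw [← hGΦ₁ _ (Φ₁.map_target hx), Φ₁.right_inv hx] at this; exact this
  -- (3) Stokes through the straightening diffeomorphism
  have hΦ₁C2 : ContDiffOn ℝ 2 Φ₁ Φ₁.source :=
    (hΦs.of_le (WithTop.coe_le_coe.2 le_top)).mono (by rw [hΦ₁src]; exact hBsrc)
  have hdet₁ : ∀ u ∈ Φ₁.source, |(fderiv ℝ Φ₁ u).det| = σ * (fderiv ℝ Φ₁ u).det := fun u hu =>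
    hdet u (hBsrc (by rw [← hΦ₁src]; exact hu))
  rw [hset, integral_extDeriv_image_superlevel_eq Φ₁ hΦ₁C2 hdet₁ hα hαs hαsupp i s]
  -- (4) on the level set, `α(Φ u)(DΦ(u) e') = φ(F u)(DF(u) e')`
  set Y : Set (Fin m → ℝ) := {y | i.insertNth s y ∈ Φ₁.source} with hY
  have hYB : ∀ y ∈ Y, i.insertNth s y ∈ B := fun y hy => by rw [← hΦ₁src]; exact hy
  have hYm : MeasurableSet Y :=
    (Φ₁.open_source.preimage (Continuous.finInsertNth i continuous_const continuous_id)).measurableSet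
  have h4 : ∫ y in Y, α (Φ₁ (i.insertNth s y))
        (fun j => fderiv ℝ Φ₁ (i.insertNth s y) (Pi.single (i.succAbove j) 1)) =
      ∫ y in Y, ⇑φ (F (i.insertNth s y))
        (fun j => fderiv ℝ F (i.insertNth s y) (Pi.single (i.succAbove j) 1)) := by
    refine setIntegral_congr_fun hYm fun y hy => ?_
    have hu : i.insertNth s y ∈ Φ.source := hBsrc (hYB y hy)
    have hΦuO : Φ (i.insertNth s y) ∈ O₀ := hΦmaps hu
    rw [hΦ₁coe]
    simp only [hα_def, hΦuO, if_true, ContinuousAlternatingMap.compContinuousLinearMap_apply,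
      Function.comp_def]
    congr 1
    funext j
    rw [hFderiv _ hu, ContinuousLinearMap.comp_apply]
  rw [h4]
  -- (5) transport to `EuclideanSpace ℝ (Fin m)`
  have hemb : MeasurableEmbedding (@ofLp 2 (Fin m → ℝ)) := by
    rw [← MeasurableEquiv.coe_toLp_symm]
    exact (MeasurableEquiv.toLp 2 (Fin m → ℝ)).symm.measurableEmbedding
  have h5 := (PiLp.volume_preserving_ofLp (Fin m)).setIntegral_preimage_emb hemb
    (fun y => ⇑φ (F (i.insertNth s y))
      (fun j => fderiv ℝ F (i.insertNth s y) (Pi.single (i.succAbove j) 1))) Y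
  have hsEY : sE = (@ofLp 2 (Fin m → ℝ)) ⁻¹' Y := by
    ext z
    simp only [hsE, hY, mem_preimage, mem_setOf_eq, hι, hΦ₁src]
  rw [← h5, ← hsEY]
  -- (6) the integrands agree and the constants match
  have h6 : ∫ z in sE, (c : ℝ) * ⇑φ (γ z) (fun j => γ' z (e j)) =
      (c : ℝ) * ∫ z in sE, ⇑φ (F (i.insertNth s (ofLp z)))
        (fun j => fderiv ℝ F (i.insertNth s (ofLp z)) (Pi.single (i.succAbove j) 1)) := by
    rw [← integral_const_mul]
    refine setIntegral_congr_fun hsEo.measurableSet fun z _ => ?_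
    simp only [hγ'e]
    rfl
  rw [h6, hc]
  ring

end Main
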